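import Mathlib
import HarnessLib
import Literature.Analysis.FluidPDE.TypeIAncientMild
import Literature.Analysis.FluidPDE.TypeIAncientMildClassical
import Literature.Analysis.FluidPDE.KNSSTypeIRateLiouvilleHolds
import Literature.Analysis.FluidPDE.BarkerPrange2020VorticityAlignmentTypeIHolds
import Literature.Analysis.FluidPDE.TsaiSelfSimilarBounded
import Literature.Analysis.FluidPDE.ChaeAsymptoticallySelfSimilarProfile
import Literature.Analysis.FluidPDE.TaoClassGlobal
import Summits.NavierStokesRegularity.NavierStokesRegularity.Theorems.PoloidalWindowDoorPoloidalWindowRigidityWindow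
import Summits.NavierStokesRegularity.NavierStokesRegularity.Theorems.AxisTwistDoorTiltDominationLocEnergyClass

/-!
# AxisTwistDoor · crux `TiltDominationLoc` (stmt-NavierStokesRegularity-26991) — SYMMETRY EXCLUSIONS for the
# hypothetical counterexample (portrait, part II: it is not translation-invariant along any line, not self-similar
# about the apex, and its vorticity is unidirectional on no time slice)

By `…AxisTwistDoorTiltDominationLocEnergyClass.oneSignedRigidity_iff_core` (p643972) the crux 26991 (wall W3 of the
NS wall board) is «no Type-I ancient Oseen-mild profile with `ω₃ = ⟪curl v, e₃⟫ ≥ 0` is backward-singular at the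
apex».  This file records, as kernel theorems over the route's four-hypothesis class (Type-I time rate, continuity on
the open backward slab, unit-viscosity Oseen identity, divergence-free slices), three SIGN-FREE exclusions that every
candidate counterexample (one-signed or not; hence also every W4/W7 candidate) must survive — each a published
Liouville theorem already PROVED in the tree, here transported to the route's class:

* §1 `eq_zero_of_lineInvariant`, `not_isBackwardSingularPoint_of_lineInvariant` — a class profile invariant under
  all translations along a line `ℝe`, `e ≠ 0`, vanishes identically (Koch–Nadirashvili–Seregin–Šverák 2009, proof of
  Thm 6.2, Liouville step: tree `KNSS2009_typeI_rate_liouville_holds`, applied to the time-shifted bounded copies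
  `t ↦ v(t − δ)` after a rotation taking `e/‖e‖` to the coordinate axis `e₂`; the pattern of
  `BarkerPrange2020VorticityAlignmentTypeIHolds`, Step E);
* §2 `eq_zero_of_selfSimilar`, `not_isBackwardSingularPoint_of_selfSimilar` — a class profile that is self-similar
  about the apex (`c·v(c²t, cx) = v(t,x)` for all `c > 0`) vanishes identically (Tsai 1998 Thm 1, `q = ∞`: bounded
  Leray profiles are constant, tree `tsai_selfsimilar_bounded_holds`; the profile equation with a free pressure by
  `isLerayProfile_of_isClassical_lerayBackward`; constants are killed by the Oseen gauge,
  `IsTypeIAncientMild.eq_zero_of_slice_const`);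
* §3 `not_isBackwardSingularPoint_of_curl_parallel_slice` — a class profile whose vorticity on ONE slice `s₀ < 0` is
  everywhere parallel to a fixed vector `e ≠ 0` is not backward-singular at the apex (Barker–Prange 2020 Prop. 4 /
  Remark 5 with Giga–Miura 2011, tree `not_isBackwardSingularPoint_of_typeIAncientMild_of_curl_parallel_slice`; the
  energy-class inputs are automatic, `exists_energyClass_of_typeI`).  For W3: a one-signed profile whose vorticity is
  VERTICAL on one slice (`ω = ω₃ e₃`, `ω₃ ≥ 0`) is not a counterexample — `not_isBackwardSingularPoint_of_vertical_
  vorticity_slice`; by real-analyticity of the slices a non-empty OPEN set of one slice suffices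
  (`not_isBackwardSingularPoint_of_curl_parallel_on_open`), so the counterexample carries NON-ZERO HORIZONTAL
  VORTICITY on a dense open subset of every slice (`exists_horizontalVorticity_ne_zero_of_singular`,
  `dense_horizontalVorticity_ne_zero_of_singular`: «it twists everywhere, at every time»).
* §4 `portrait_symmetry` — the three exclusions packaged for the negation lens (cell ns-wall-extremal, ideators).

WHAT THIS IS NOT: the axisymmetric (with swirl) and the discretely self-similar cells are NOT treated here (KNSS 2009
Thm 6.3 is typed in the tree only for Leray–Hopf data; λ-DSS is open); nothing here proves the crux, the walls W4/W6,
the leaf `HalfSpaceWindowDoor.Target` or any Navier–Stokes regularity statement (Clay A OPEN).  Seat ns-atd-p1 (LEAD g4).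
[cite: KochNadirashviliSereginSverak2009, Thm 5.1, Rem 6.1, proof of Thm 6.2 (arXiv:0709.3599 p. 13); Tsai1998, Thm 1;
BarkerPrange2020Alignment, Prop. 4 and Rem. 5 (arXiv:1906.08225 p. 5)]
-/

noncomputable section

-- the summit and its single sub-problem share the name (CONVENTIONS §1), as in every Theorems file
set_option linter.dupNamespace false

namespace Summit.NavierStokesRegularity.NavierStokesRegularity.Theorems.AxisTwistDoorTiltDominationLocSymmetryExclusions

open Set Function Filter Topology MeasureTheory Metric
open scoped ENNReal InnerProductSpace
open Literature.Analysis Literature.Analysis.FluidPDE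
open Summit.NavierStokesRegularity.NavierStokesRegularity.Theorems.PoloidalWindowDoorPoloidalWindowRigidityWindow
  (isTypeIAncientMild_of_class)
open Summit.NavierStokesRegularity.NavierStokesRegularity.Theorems.AxisTwistDoorTiltDominationLocEnergyClass
  (exists_energyClass_of_typeI)

variable {C : ℝ} {v : ℝ → EuclideanSpace ℝ (Fin 3) → EuclideanSpace ℝ (Fin 3)}

/-! ### §0 Two pieces of plumbing -/

/-- A field vanishing identically on the open backward slab is not backward-singular at the apex `(0,0)`: its
`L^∞` norm on the parabolic cylinder `Q((0,0),1) ⊆ (−1,0) × ℝ³` is `0 < ∞`. -/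
theorem not_isBackwardSingularPoint_of_eq_zero (h0 : ∀ t < (0 : ℝ), ∀ x, v t x = 0) :
    ¬ IsBackwardSingularPoint v 0 := by
  intro hsing
  have hnorm : eLpNorm (uncurry v) ⊤
      (volume.restrict (parabolicCylinder 1 (0 : ℝ × (EuclideanSpace ℝ (Fin 3))))) = 0 := by
    rw [eLpNorm_congr_ae (g := 0) ?_, eLpNorm_zero]
    filter_upwards [ae_restrict_mem (isOpen_parabolicCylinder _ _).measurableSet] with w hw
    have hw0 : w.1 < 0 := by
      rw [mem_parabolicCylinder] at hw
      simpa using hw.1.2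
    exact h0 w.1 hw0 w.2
  exact ENNReal.zero_ne_top ((hnorm.symm.trans (hsing 1 one_pos)))

/-- A linear isometry of `ℝ³` taking a given unit vector to the coordinate vector `e₂` (Lean index `1`): the
Householder reflection in the hyperplane orthogonal to `a − e₂` (Mathlib's `Submodule.reflection_sub`). -/
theorem exists_linearIsometryEquiv_apply_eq_single_one {a : EuclideanSpace ℝ (Fin 3)} (ha : ‖a‖ = 1) :
    ∃ R : (EuclideanSpace ℝ (Fin 3)) ≃ₗᵢ[ℝ] (EuclideanSpace ℝ (Fin 3)),
      R (EuclideanSpace.single (1 : Fin 3) (1 : ℝ)) = a := by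
  have h1 : ‖(EuclideanSpace.single (1 : Fin 3) (1 : ℝ) : EuclideanSpace ℝ (Fin 3))‖ = ‖a‖ := by simp [ha]
  exact ⟨_, Submodule.reflection_sub h1⟩

/-! ### §1 Translation invariance along a line ⇒ the profile vanishes (KNSS 2009, Thm 6.2, Liouville step) -/

/-- **KNSS for the Oseen-gauge Type-I class, any direction.**  A Type-I ancient mild field (`IsTypeIAncientMild C v`)
invariant under every translation along a line `ℝe`, `e ≠ 0`, vanishes identically on the open backward slab:
rotate `e/‖e‖` to `e₂`, pass to the bounded time-shifted copies `t ↦ v(t − δ)` (`comp_sub_right`,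
`isBoundedOn`), apply `KNSS2009_typeI_rate_liouville_holds`, and let `δ = −t/2`. [cite: KochNadirashviliSereginSverak2009,
proof of Thm 6.2 (arXiv:0709.3599 p. 13), Thm 5.1 and Remark 6.1] -/
theorem eq_zero_of_typeIAncientMild_of_lineInvariant (hv : IsTypeIAncientMild C v)
    {e : EuclideanSpace ℝ (Fin 3)} (he : e ≠ 0)
    (hinv : ∀ t < (0 : ℝ), ∀ (x : EuclideanSpace ℝ (Fin 3)) (r : ℝ), v t (x + r • e) = v t x) :
    ∀ t < (0 : ℝ), ∀ x, v t x = 0 := by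
  have hC : 0 ≤ C := hv.nonneg
  set a : EuclideanSpace ℝ (Fin 3) := ‖e‖⁻¹ • e with ha
  have ha1 : ‖a‖ = 1 := by
    rw [ha, norm_smul, norm_inv, norm_norm, inv_mul_cancel₀ (norm_ne_zero_iff.2 he)]
  obtain ⟨Rot, hRot⟩ := exists_linearIsometryEquiv_apply_eq_single_one ha1
  have hzero : ∀ δ : ℝ, 0 < δ → ∀ t < (0 : ℝ), ∀ x, v (t - δ) x = 0 := by
    intro δ hδ
    have hV := hv.comp_sub_right hδ.le
    set W : ℝ → (EuclideanSpace ℝ (Fin 3)) → (EuclideanSpace ℝ (Fin 3)) :=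
      fun t y => Rot.symm (v (t - δ) (Rot y)) with hW
    have hWc : ContinuousOn (uncurry W) (Iio 0 ×ˢ univ) := by
      rw [show uncurry W = Rot.symm ∘ uncurry (fun t => v (t - δ)) ∘
          fun q : ℝ × (EuclideanSpace ℝ (Fin 3)) => (q.1, Rot q.2) from funext fun q => rfl]
      refine Rot.symm.continuous.comp_continuousOn (hV.continuousOn_uncurry.comp
        (continuous_fst.prodMk (Rot.continuous.comp continuous_snd)).continuousOn ?_)
      intro q hq
      exact ⟨hq.1, mem_univ _⟩
    obtain ⟨K, hK⟩ := hv.isBoundedOn hδ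
    have hWbd : ∃ K : ℝ, ∀ t < 0, ∀ x, ‖W t x‖ ≤ K :=
      ⟨K, fun t ht x => by
        show ‖Rot.symm (v (t - δ) (Rot x))‖ ≤ K
        rw [LinearIsometryEquiv.norm_map]
        exact hK (t - δ) (by simp only [mem_Iio]; linarith) (Rot x)⟩
    have hWdiv : ∀ t < 0, IsWeaklyDivFree (W t) := by
      intro t ht
      have h1 := (hV.isWeaklyDivFree ht).conj_linearIsometryEquiv Rot.symm
      simpa only [LinearIsometryEquiv.symm_symm] using h1
    have hWmild : ∀ s t : ℝ, s < t → t < 0 → ∀ x,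
        W t x = UnboundedOperators.heatExtension (W s) (t - s) x - oseenDuhamel 1 s W W t x := by
      intro s t hst ht x
      have key := hV.mild_eq_heatExtension hst ht (Rot x)
      show Rot.symm (v (t - δ) (Rot x)) = _
      have key' : v (t - δ) (Rot x) = UnboundedOperators.heatExtension (fun y => v (s - δ) y) (t - s) (Rot x) -
          oseenDuhamel 1 s (fun τ => v (τ - δ)) (fun τ => v (τ - δ)) t (Rot x) := key
      rw [key', map_sub]
      congr 1
      · have h2 := heatExtension_conj_linearIsometryEquiv Rot.symm (fun y => v (s - δ) y) (t - s) x
        simp only [LinearIsometryEquiv.symm_symm] at h2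
        exact h2.symm
      · exact (oseenDuhamel_symm_conj_linearIsometryEquiv Rot 1 s (fun τ => v (τ - δ))
          (fun τ => v (τ - δ)) t x).symm
    have hWinv : ∀ t < 0, ∀ (x : EuclideanSpace ℝ (Fin 3)) (d : ℝ),
        W t (x + EuclideanSpace.single 1 d) = W t x := by
      intro t ht x d
      show Rot.symm (v (t - δ) (Rot (x + EuclideanSpace.single 1 d))) = Rot.symm (v (t - δ) (Rot x))
      have hsingle : (EuclideanSpace.single (1 : Fin 3) d : EuclideanSpace ℝ (Fin 3)) =
          d • EuclideanSpace.single (1 : Fin 3) (1 : ℝ) := by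
        ext j
        simp
      rw [map_add, hsingle, map_smul, hRot, ha, smul_smul, hinv (t - δ) (by linarith) (Rot x) (d * ‖e‖⁻¹)]
    have hWrate : ∀ t < 0, ∀ x, Real.sqrt (-t) * ‖W t x‖ ≤ C := by
      intro t ht x
      show Real.sqrt (-t) * ‖Rot.symm (v (t - δ) (Rot x))‖ ≤ C
      rw [LinearIsometryEquiv.norm_map]
      have h1 := hv.norm_le (by linarith : t - δ < 0) (Rot x)
      have hs1 : 0 < Real.sqrt (-(t - δ)) := Real.sqrt_pos.2 (by linarith)
      have hs2 : Real.sqrt (-t) ≤ Real.sqrt (-(t - δ)) := Real.sqrt_le_sqrt (by linarith)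
      have hq : 0 ≤ C / Real.sqrt (-(t - δ)) := div_nonneg hC hs1.le
      calc Real.sqrt (-t) * ‖v (t - δ) (Rot x)‖
          ≤ Real.sqrt (-t) * (C / Real.sqrt (-(t - δ))) := by gcongr
        _ ≤ Real.sqrt (-(t - δ)) * (C / Real.sqrt (-(t - δ))) := by gcongr
        _ = C := by field_simp
    have hW0 := KNSS2009_typeI_rate_liouville_holds hWc hWbd hWdiv hWmild hWinv hWrate
    intro t ht x
    have h1 := hW0 t ht (Rot.symm x)
    have h1' : Rot.symm (v (t - δ) (Rot (Rot.symm x))) = 0 := h1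
    rw [LinearIsometryEquiv.apply_symm_apply] at h1'
    exact Rot.symm.injective (by rw [h1', map_zero])
  intro t ht x
  have h := hzero (-t / 2) (by linarith) (t / 2) (by linarith) x
  rwa [show t / 2 - -t / 2 = t by ring] at h

/-- **The route's class profile, invariant along a line, vanishes** (KNSS 2009, Thm 6.2, Liouville step, for the
four-hypothesis class). [cite: KochNadirashviliSereginSverak2009, proof of Thm 6.2 (arXiv:0709.3599 p. 13)] -/
theorem eq_zero_of_lineInvariant (hrate : HasTypeITimeDecay C v)
    (hcont : ContinuousOn (uncurry v) (Iio (0 : ℝ) ×ˢ univ))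
    (hmild : ∀ s t : ℝ, s < t → t < 0 → ∀ x,
      v t x = UnboundedOperators.heatExtension (v s) (t - s) x - oseenDuhamel 1 s v v t x)
    (hdiv : ∀ t < 0, VectorCalculus.IsDivFree (v t))
    {e : EuclideanSpace ℝ (Fin 3)} (he : e ≠ 0)
    (hinv : ∀ t < (0 : ℝ), ∀ (x : EuclideanSpace ℝ (Fin 3)) (r : ℝ), v t (x + r • e) = v t x) :
    ∀ t < (0 : ℝ), ∀ x, v t x = 0 :=
  eq_zero_of_typeIAncientMild_of_lineInvariant (isTypeIAncientMild_of_class hrate hcont hmild hdiv) he hinv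

/-- **Portrait clause (vi)**: a class profile invariant under all translations along some line is NOT
backward-singular at the apex — the hypothetical counterexample of W3 (and of W4, W7) is not a 2.5D flow in any
direction. [cite: KochNadirashviliSereginSverak2009, proof of Thm 6.2 (arXiv:0709.3599 p. 13)] -/
theorem not_isBackwardSingularPoint_of_lineInvariant (hrate : HasTypeITimeDecay C v)
    (hcont : ContinuousOn (uncurry v) (Iio (0 : ℝ) ×ˢ univ))
    (hmild : ∀ s t : ℝ, s < t → t < 0 → ∀ x,
      v t x = UnboundedOperators.heatExtension (v s) (t - s) x - oseenDuhamel 1 s v v t x)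
    (hdiv : ∀ t < 0, VectorCalculus.IsDivFree (v t))
    {e : EuclideanSpace ℝ (Fin 3)} (he : e ≠ 0)
    (hinv : ∀ t < (0 : ℝ), ∀ (x : EuclideanSpace ℝ (Fin 3)) (r : ℝ), v t (x + r • e) = v t x) :
    ¬ IsBackwardSingularPoint v 0 :=
  not_isBackwardSingularPoint_of_eq_zero (eq_zero_of_lineInvariant hrate hcont hmild hdiv he hinv)

/-! ### §2 Self-similarity about the apex ⇒ the profile vanishes (Tsai 1998, Thm 1, `q = ∞`) -/

/-- **Tsai for the Oseen-gauge Type-I class.**  A Type-I ancient mild field that is self-similar about the apex,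
`c • v(c²t, c x) = v(t, x)` for all `c > 0`, `t < 0`, vanishes identically: `v(t) = (−t)^{-1/2} U(·/√(−t))` with
`U = v(−1)` smooth and bounded (`‖U‖ ≤ C`); with a classical pressure `q` on `(−2, 0)`
(`exists_isClassicalNSSolutionOn_Ioo`) the pair `(U, q(−1))` is a Leray profile (`a = ½`, `T = 0`, normalised time
`−1`; `isLerayProfile_of_isClassical_lerayBackward`), so `U` is constant (Tsai 1998 Thm 1, `tsai_selfsimilar_bounded_
holds`), every slice of `v` is spatially constant, and the Oseen gauge kills it (`eq_zero_of_slice_const`). [cite: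
Tsai1998, Thm 1 (p. 31) and §5 (p. 48)] -/
theorem eq_zero_of_typeIAncientMild_of_selfSimilar (hv : IsTypeIAncientMild C v)
    (hss : ∀ c : ℝ, 0 < c → ∀ t < (0 : ℝ), ∀ x : EuclideanSpace ℝ (Fin 3), c • v (c ^ 2 * t) (c • x) = v t x) :
    ∀ t < (0 : ℝ), ∀ x, v t x = 0 := by
  set U : EuclideanSpace ℝ (Fin 3) → EuclideanSpace ℝ (Fin 3) := v (-1) with hU
  -- the self-similar form of the slices: `v t = lerayBackward ½ 0 U t` for `t < 0`
  have hform : ∀ t < (0 : ℝ), v t = lerayBackward (1 / 2) 0 U t := by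
    intro t ht
    funext x
    have hnt : 0 < -t := neg_pos.2 ht
    set c : ℝ := Real.sqrt (-t) with hc
    have hc0 : 0 < c := Real.sqrt_pos.2 hnt
    have hcc : c ^ 2 = -t := by rw [hc, Real.sq_sqrt hnt.le]
    have key := hss c hc0 (-1) (by norm_num) (c⁻¹ • x)
    rw [smul_smul, mul_inv_cancel₀ hc0.ne', one_smul, hcc, show -t * -1 = t by ring, ← hU] at key
    -- `key : c • v t x = U (c⁻¹ • x)`
    rw [lerayBackward_apply, show (2 : ℝ) * (1 / 2) * (0 - t) = -t by ring, ← hc, ← key, smul_smul,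
      inv_mul_cancel₀ hc0.ne', one_smul]
  -- a classical pressure on the window `(−2, 0)` and Leray's reduction at the normalised time `−1`
  obtain ⟨q, hcl⟩ := hv.exists_isClassicalNSSolutionOn_Ioo (t₀ := -2) (by norm_num)
  have hcl' : IsClassicalNSSolutionOn (Ioo (-2 : ℝ) 0) 1 0 (lerayBackward (1 / 2) 0 U) q :=
    hcl.congr_slices (fun t ht => (hform t ht.2).symm) fun _ _ => rfl
  have hUs : ContDiff ℝ (⊤ : ℕ∞) U := hv.contDiff_slice (by norm_num)
  have hint : (0 : ℝ) - (2 * (1 / 2 : ℝ))⁻¹ ∈ interior (Ioo (-2 : ℝ) 0) := by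
    rw [interior_Ioo]
    norm_num
  have hprof : IsLerayProfile 1 (1 / 2) U (q ((0 : ℝ) - (2 * (1 / 2 : ℝ))⁻¹)) :=
    isLerayProfile_of_isClassical_lerayBackward (by norm_num) hUs hint hcl'
  -- `U` is bounded by `C`, hence constant (Tsai 1998, Thm 1, `q = ∞`)
  have hUbd : ∃ M : ℝ, ∀ y, ‖U y‖ ≤ M := ⟨C, fun y => by
    have h := hv.norm_le (t := -1) (by norm_num) y
    rwa [neg_neg, Real.sqrt_one, div_one] at h⟩
  obtain ⟨b, hb⟩ := tsai_selfsimilar_bounded_holds one_pos (by norm_num : (0 : ℝ) < 1 / 2) hprof hUbd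
  -- every slice is spatially constant; the gauge kills it
  have hconst : ∀ t < (0 : ℝ), ∀ x, v t x = (Real.sqrt (2 * (1 / 2) * (0 - t)))⁻¹ • b := by
    intro t ht x
    rw [hform t ht, lerayBackward_apply, hb]
  exact fun t ht x => hv.eq_zero_of_slice_const hconst ht x

/-- **The route's class profile, self-similar about the apex, vanishes** (Tsai 1998 Thm 1 for the four-hypothesis
class). [cite: Tsai1998, Thm 1 (p. 31)] -/
theorem eq_zero_of_selfSimilar (hrate : HasTypeITimeDecay C v)
    (hcont : ContinuousOn (uncurry v) (Iio (0 : ℝ) ×ˢ univ))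
    (hmild : ∀ s t : ℝ, s < t → t < 0 → ∀ x,
      v t x = UnboundedOperators.heatExtension (v s) (t - s) x - oseenDuhamel 1 s v v t x)
    (hdiv : ∀ t < 0, VectorCalculus.IsDivFree (v t))
    (hss : ∀ c : ℝ, 0 < c → ∀ t < (0 : ℝ), ∀ x : EuclideanSpace ℝ (Fin 3), c • v (c ^ 2 * t) (c • x) = v t x) :
    ∀ t < (0 : ℝ), ∀ x, v t x = 0 :=
  eq_zero_of_typeIAncientMild_of_selfSimilar (isTypeIAncientMild_of_class hrate hcont hmild hdiv) hss

/-- **Portrait clause (v)**: a class profile self-similar about the apex is NOT backward-singular there — the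
hypothetical counterexample of W3 (and of W4, W7) is not a Leray self-similar profile (any symmetry, any sign).
[cite: Tsai1998, Thm 1 (p. 31)] -/
theorem not_isBackwardSingularPoint_of_selfSimilar (hrate : HasTypeITimeDecay C v)
    (hcont : ContinuousOn (uncurry v) (Iio (0 : ℝ) ×ˢ univ))
    (hmild : ∀ s t : ℝ, s < t → t < 0 → ∀ x,
      v t x = UnboundedOperators.heatExtension (v s) (t - s) x - oseenDuhamel 1 s v v t x)
    (hdiv : ∀ t < 0, VectorCalculus.IsDivFree (v t))
    (hss : ∀ c : ℝ, 0 < c → ∀ t < (0 : ℝ), ∀ x : EuclideanSpace ℝ (Fin 3), c • v (c ^ 2 * t) (c • x) = v t x) :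
    ¬ IsBackwardSingularPoint v 0 :=
  not_isBackwardSingularPoint_of_eq_zero (eq_zero_of_selfSimilar hrate hcont hmild hdiv hss)

/-! ### §3 Unidirectional vorticity on one slice ⇒ the apex is regular (Barker–Prange 2020 / Giga–Miura 2011) -/

/-- **Barker–Prange for the route's class.**  If the vorticity of a class profile is, on ONE slice `s₀ < 0`,
everywhere parallel to a fixed vector `e ≠ 0` (`curl v(s₀) y = a(y) e`), the apex is not backward-singular: the
energy-class inputs (slab suitability, weak gradient, `𝐈 < ∞`) are automatic (`exists_energyClass_of_typeI`), and
the tree's `not_isBackwardSingularPoint_of_typeIAncientMild_of_curl_parallel_slice` applies. [cite: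
BarkerPrange2020Alignment, Prop. 4 and Remark 5 (arXiv:1906.08225 p. 5)] -/
theorem not_isBackwardSingularPoint_of_curl_parallel_slice (hrate : HasTypeITimeDecay C v)
    (hcont : ContinuousOn (uncurry v) (Iio (0 : ℝ) ×ˢ univ))
    (hmild : ∀ s t : ℝ, s < t → t < 0 → ∀ x,
      v t x = UnboundedOperators.heatExtension (v s) (t - s) x - oseenDuhamel 1 s v v t x)
    (hdiv : ∀ t < 0, VectorCalculus.IsDivFree (v t))
    {s₀ : ℝ} (hs₀ : s₀ < 0) {e : EuclideanSpace ℝ (Fin 3)} (he : e ≠ 0)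
    (hpar : ∀ y, ∃ a : ℝ, curl (v s₀) y = a • e) :
    ¬ IsBackwardSingularPoint v 0 := by
  obtain ⟨π, H, hsw, hwg, hI⟩ := exists_energyClass_of_typeI hrate hcont hmild hdiv
  exact not_isBackwardSingularPoint_of_typeIAncientMild_of_curl_parallel_slice
    (isTypeIAncientMild_of_class hrate hcont hmild hdiv) hsw hwg hI hs₀ he hpar

/-- **Unidirectional vorticity on a non-empty OPEN subset of one slice suffices** (slices of the class are
real-analytic, `IsTypeIAncientMild.analyticOnNhd_slice_univ`; globalisation `curl_parallel_of_parallel_on_open`): if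
`curl v(s₀)` is parallel to a fixed `e ≠ 0` on a non-empty open set of one slice `s₀ < 0`, the apex is not
backward-singular. [cite: BarkerPrange2020Alignment, Prop. 4 and Remark 5 (arXiv:1906.08225 p. 5); LemarieRieusset2016,
Thm. 9.12 (analyticity)] -/
theorem not_isBackwardSingularPoint_of_curl_parallel_on_open (hrate : HasTypeITimeDecay C v)
    (hcont : ContinuousOn (uncurry v) (Iio (0 : ℝ) ×ˢ univ))
    (hmild : ∀ s t : ℝ, s < t → t < 0 → ∀ x,
      v t x = UnboundedOperators.heatExtension (v s) (t - s) x - oseenDuhamel 1 s v v t x)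
    (hdiv : ∀ t < 0, VectorCalculus.IsDivFree (v t))
    {s₀ : ℝ} (hs₀ : s₀ < 0) {e : EuclideanSpace ℝ (Fin 3)} (he : e ≠ 0)
    {S : Set (EuclideanSpace ℝ (Fin 3))} (hS : IsOpen S) (hne : S.Nonempty)
    (hpar : ∀ y ∈ S, ∃ a : ℝ, curl (v s₀) y = a • e) :
    ¬ IsBackwardSingularPoint v 0 :=
  not_isBackwardSingularPoint_of_curl_parallel_slice hrate hcont hmild hdiv hs₀ he
    (curl_parallel_of_parallel_on_open
      ((isTypeIAncientMild_of_class hrate hcont hmild hdiv).analyticOnNhd_slice_univ hs₀) hS hne hpar)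

/-- **One-signed and VERTICAL on one slice ⇒ regular apex.**  For W3: if on one slice `s₀ < 0` the horizontal
vorticity vanishes identically (`curl v(s₀) y = ⟪curl v(s₀) y, e₃⟫ e₃`), the apex is not backward-singular — whether
or not `ω₃ ≥ 0`.  So «tilt domination with `K = M = 0` on a single slice» already decides the crux's conclusion.
[cite: BarkerPrange2020Alignment, Prop. 4 and Remark 5 (arXiv:1906.08225 p. 5)] -/
theorem not_isBackwardSingularPoint_of_vertical_vorticity_slice (hrate : HasTypeITimeDecay C v)
    (hcont : ContinuousOn (uncurry v) (Iio (0 : ℝ) ×ˢ univ))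
    (hmild : ∀ s t : ℝ, s < t → t < 0 → ∀ x,
      v t x = UnboundedOperators.heatExtension (v s) (t - s) x - oseenDuhamel 1 s v v t x)
    (hdiv : ∀ t < 0, VectorCalculus.IsDivFree (v t))
    {s₀ : ℝ} (hs₀ : s₀ < 0)
    (hvert : ∀ y, curl (v s₀) y =
      ⟪curl (v s₀) y, (EuclideanSpace.single (2 : Fin 3) (1 : ℝ))⟫_ℝ • EuclideanSpace.single (2 : Fin 3) (1 : ℝ)) :
    ¬ IsBackwardSingularPoint v 0 :=
  not_isBackwardSingularPoint_of_curl_parallel_slice hrate hcont hmild hdiv hs₀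
    AxisTwistDoorTiltDominationLocRigidity.e3_ne_zero fun y => ⟨_, hvert y⟩

/-- **Portrait clause (vii)**: a class profile backward-singular at the apex carries NON-ZERO HORIZONTAL VORTICITY
somewhere on every slice: `ω(s) − ⟪ω(s), e₃⟫e₃ ≢ 0` for each `s < 0`.  (For the one-signed counterexample of W3 this
is the first quantitative content of «it twists»: vertical vorticity alone never produces the singularity.) [cite:
BarkerPrange2020Alignment, Prop. 4 and Remark 5 (arXiv:1906.08225 p. 5)] -/
theorem exists_horizontalVorticity_ne_zero_of_singular (hrate : HasTypeITimeDecay C v)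
    (hcont : ContinuousOn (uncurry v) (Iio (0 : ℝ) ×ˢ univ))
    (hmild : ∀ s t : ℝ, s < t → t < 0 → ∀ x,
      v t x = UnboundedOperators.heatExtension (v s) (t - s) x - oseenDuhamel 1 s v v t x)
    (hdiv : ∀ t < 0, VectorCalculus.IsDivFree (v t))
    (hsing : IsBackwardSingularPoint v 0) :
    ∀ s < (0 : ℝ), ∃ y, curl (v s) y -
      ⟪curl (v s) y, (EuclideanSpace.single (2 : Fin 3) (1 : ℝ))⟫_ℝ • EuclideanSpace.single (2 : Fin 3) (1 : ℝ) ≠ 0 := by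
  intro s hs
  by_contra hall
  push Not at hall
  exact not_isBackwardSingularPoint_of_vertical_vorticity_slice hrate hcont hmild hdiv hs
    (fun y => (sub_eq_zero.1 (hall y))) hsing

/-- **Portrait clause (vii′): the horizontal vorticity of the counterexample is non-zero on a DENSE subset of every
slice.**  If a class profile is backward-singular at the apex then, for every `s < 0`, the set
`{y | ω(s,y) − ⟪ω(s,y), e₃⟫e₃ ≠ 0}` is dense in `ℝ³` (it is also open, by continuity): on any non-empty open set where
the horizontal vorticity vanished, `curl v(s)` would be parallel to `e₃`, and `not_isBackwardSingularPoint_of_curl_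
parallel_on_open` would make the apex regular.  «The one-signed counterexample twists everywhere, at every time.»
[cite: BarkerPrange2020Alignment, Prop. 4 and Remark 5 (arXiv:1906.08225 p. 5); LemarieRieusset2016, Thm. 9.12] -/
theorem dense_horizontalVorticity_ne_zero_of_singular (hrate : HasTypeITimeDecay C v)
    (hcont : ContinuousOn (uncurry v) (Iio (0 : ℝ) ×ˢ univ))
    (hmild : ∀ s t : ℝ, s < t → t < 0 → ∀ x,
      v t x = UnboundedOperators.heatExtension (v s) (t - s) x - oseenDuhamel 1 s v v t x)
    (hdiv : ∀ t < 0, VectorCalculus.IsDivFree (v t))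
    (hsing : IsBackwardSingularPoint v 0) {s : ℝ} (hs : s < 0) :
    Dense {y : EuclideanSpace ℝ (Fin 3) | curl (v s) y -
      ⟪curl (v s) y, (EuclideanSpace.single (2 : Fin 3) (1 : ℝ))⟫_ℝ • EuclideanSpace.single (2 : Fin 3) (1 : ℝ) ≠ 0} := by
  rw [dense_iff_inter_open]
  intro O hO hOne
  by_contra hempty
  rw [Set.not_nonempty_iff_eq_empty] at hempty
  have hpar : ∀ y ∈ O, ∃ a : ℝ, curl (v s) y = a • EuclideanSpace.single (2 : Fin 3) (1 : ℝ) := by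
    intro y hy
    refine ⟨⟪curl (v s) y, (EuclideanSpace.single (2 : Fin 3) (1 : ℝ))⟫_ℝ, ?_⟩
    by_contra hne
    have hmem : y ∈ O ∩ {y : EuclideanSpace ℝ (Fin 3) | curl (v s) y -
        ⟪curl (v s) y, (EuclideanSpace.single (2 : Fin 3) (1 : ℝ))⟫_ℝ •
          EuclideanSpace.single (2 : Fin 3) (1 : ℝ) ≠ 0} := ⟨hy, fun h0 => hne (sub_eq_zero.1 h0)⟩
    rw [hempty] at hmem
    exact hmem
  exact not_isBackwardSingularPoint_of_curl_parallel_on_open hrate hcont hmild hdiv hs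
    AxisTwistDoorTiltDominationLocRigidity.e3_ne_zero hO hOne hpar hsing

/-! ### §4 The three exclusions packaged (portrait, part II) -/

/-- **PORTRAIT OF THE COUNTEREXAMPLE, PART II (symmetries).**  A Type-I ancient Oseen-mild profile that IS
backward-singular at the apex (in particular any counterexample to W3 = crux 26991 in core form, to W4 = 19708, or to
W7) is: (a) invariant under the translations along NO line `ℝe`, `e ≠ 0` (KNSS 2009); (b) NOT self-similar about the
apex (Tsai 1998); (c) on NO slice `s < 0` is its vorticity everywhere parallel to one fixed vector (Barker–Prange
2020 / Giga–Miura 2011).  All three sign-free; the sign `ω₃ ≥ 0` is not used. [cite: KochNadirashviliSereginSverak2009,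
proof of Thm 6.2; Tsai1998, Thm 1; BarkerPrange2020Alignment, Prop. 4 and Rem. 5] -/
theorem portrait_symmetry (hrate : HasTypeITimeDecay C v)
    (hcont : ContinuousOn (uncurry v) (Iio (0 : ℝ) ×ˢ univ))
    (hmild : ∀ s t : ℝ, s < t → t < 0 → ∀ x,
      v t x = UnboundedOperators.heatExtension (v s) (t - s) x - oseenDuhamel 1 s v v t x)
    (hdiv : ∀ t < 0, VectorCalculus.IsDivFree (v t))
    (hsing : IsBackwardSingularPoint v 0) :
    (∀ e : EuclideanSpace ℝ (Fin 3), e ≠ 0 →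
        ¬ ∀ t < (0 : ℝ), ∀ (x : EuclideanSpace ℝ (Fin 3)) (r : ℝ), v t (x + r • e) = v t x) ∧
      (¬ ∀ c : ℝ, 0 < c → ∀ t < (0 : ℝ), ∀ x : EuclideanSpace ℝ (Fin 3), c • v (c ^ 2 * t) (c • x) = v t x) ∧
      (∀ s < (0 : ℝ), ∀ e : EuclideanSpace ℝ (Fin 3), e ≠ 0 → ¬ ∀ y, ∃ a : ℝ, curl (v s) y = a • e) :=
  ⟨fun _ he hinv => not_isBackwardSingularPoint_of_lineInvariant hrate hcont hmild hdiv he hinv hsing,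
    fun hss => not_isBackwardSingularPoint_of_selfSimilar hrate hcont hmild hdiv hss hsing,
    fun _ hs _ he hpar => not_isBackwardSingularPoint_of_curl_parallel_slice hrate hcont hmild hdiv hs he hpar hsing⟩

end Summit.NavierStokesRegularity.NavierStokesRegularity.Theorems.AxisTwistDoorTiltDominationLocSymmetryExclusions

end
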